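import Literature.NumberTheory.EllipticCurves.AnomalousOfRationalTorsionProofs
import Literature.NumberTheory.EllipticCurves.LeadingTermProofs
import HarnessLib

/-!
# Certificates that a rational point has infinite order, and `1 ≤ rank_ℤ E(ℚ)` from one such point
# (Silverman, *AEC*, VII.3.1(b), VII.3.4 / IV.6.1, VIII.6.7 — kernel checkers, theorems only)

HONEST FRAMING (BSD rank-`≤ 1` residual cell `b2b-bsdres`, home
`run/shared/lean/b2b/bsd-rank1-residual/`, lane CLASS-CLOSURE, seat cc-typer-2 = typer of record
N10 / O7): the cell deletes the COMBINATION-SHAPED residual classes of the rank-`≤ 1` BSD formula from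
PUBLISHED theorems only and TYPES the construction-shaped ones; research routes, no claim beyond the
stated classes; census and instrument output are EVIDENCE; a certificate column is INSTRUMENTATION;
nothing is booked by this file; no RESIDUAL-MAP mark moves. THEOREMS ONLY: no definition, no named
fact, net debt `0`.

WHY. The congruence-transport END theorems on the defect-`2` rows of N10 / O7
(`Summits/…/AdditivePotMult/MixedCongruentPartnerEPW.lean`, `…/PotMultCongruentPartnerMainConjecture.lean`;
class-closure `N10/TRANSPORT-TEMPLATE.md` v1.9) take, for the CLOSED partner `E₁`, the input
`hr₁ : r₁ ≤ E₁.mordellWeilRank` (used through `le_lambdaInvariant_of_le_mordellWeilRank`). For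
`r₁ = 1` that is ONE rational point of infinite order. The lane fixed a per-row certificate column
for it (`class-closure/typer-5/RANK1-POINT-CERT-FORMAT.md`, kinds `NL` / `RED2` / `MULT12`) and
recorded that "no generic checker" was in the tree. This file is the generic checker: every
ingredient IS a tree theorem already —
`Literature.NumberTheory.EllipticCurves.not_isOfFinAddOrder_of_one_lt_padicNorm_holds`
(`E₁(ℚ_p) ∩ E(ℚ)` is torsion-free for `p` odd, AEC VII.3.4 / IV.6.1, by division polynomials),
`…reductionPointCount_nsmul_eq_zero_of_isOfFinAddOrder` (`#Ẽ(𝔽_p) · T = O` for rational torsion `T`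
at a good odd `p`, AEC VII.2.1 + VII.3.1(b)), `WeierstrassCurve.module_finite_point_holds`
(Mordell–Weil, AEC VIII.6.7) and `…one_le_mordellWeilRank_of_not_isOfFinAddOrder` (a point of
infinite order in a finitely generated `E(F)` gives `1 ≤ rank_ℤ`) — so the column is read by ONE
theorem call per row, with a DECIDABLE hypothesis.

## Statements (`W/ℚ` a globally minimal elliptic curve — Cremona's reduced minimal models are —
## `p` an odd prime)

* (private) `one_lt_padicNorm_ratCast_of_dvd_den` — `p ∣ den(x) ⇒ ‖x‖_p > 1` (`x ∈ ℚ`;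
  numerator and denominator coprime; tree `max_one_norm_ratCast`).
* `not_isOfFinAddOrder_of_dvd_den` — **kind `NL` (Lutz–Nagell / AEC VII.3.4 at ONE odd prime)**: a
  rational point `P = (x, y)` with `p ∣ den(x)` for some odd prime `p` has INFINITE ORDER. No
  reduction hypothesis at `p`. Decidable from `P` alone. (For a point with `x ∈ ℤ[1/2]` apply it to
  any other rational point of the curve with a denominator, e.g. a small multiple: ANY rational point
  of infinite order certifies `hr₁`, the certificate need not be the listed generator.)
* `nsmul_ne_zero_of_dvd_den` — the same as `n • P ≠ O` for every `n > 0`.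
* `not_isOfFinAddOrder_of_reductionPointCount_nsmul_ne_zero` — **kind `NRED` (AEC VII.3.1(b) at ONE
  good odd prime)**: if `p ∤ Δ_W` and `N_p • T ≠ O` with `N_p = #Ẽ(𝔽_p) = W.reductionPointCount p`,
  then `T` has infinite order (the order of a rational torsion point divides `N_p`). This subsumes
  the format's `RED2` (two good odd primes with different reduction orders): a point passing `RED2`
  is non-torsion, hence passes `NRED` at every good odd prime; `NRED` needs one prime and no order
  computation in `Ẽ(𝔽_p)` beyond `N_p`.
* `one_le_mordellWeilRank_of_dvd_den`, `one_le_mordellWeilRank_of_reductionPointCount_nsmul_ne_zero`,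
  `one_le_mordellWeilRank_of_not_isOfFinAddOrder_rat` — **`1 ≤ rank_ℤ E(ℚ)`** from either
  certificate (Mordell–Weil + the glue lemma), the exact shape of the consumer input `hr₁` with
  `r₁ = 1`.

Kind `MULT12` of the format (`k • P ≠ O` for `k ≤ 12`) rests on Mazur's torsion theorem, a NAMED FACT
in the tree (`MazurTorsion`), and is therefore not given a checker here (it would carry that fact as
a hypothesis); `NL` / `NRED` are fact-free. No `p = 2` statement (`E₁(ℚ₂)` may contain `2`-torsion).

## References
* J. H. Silverman, *The Arithmetic of Elliptic Curves*, 2nd ed., GTM 106 (2009): VII.2.1 (reduction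
  is a homomorphism with kernel `E₁`), VII.3.1(b) (torsion injects at a good prime `p ∤ m`), VII.3.4
  with IV.6.1 (no torsion in `E₁(ℚ_p)` for `p` odd; Lutz–Nagell denominators), VIII.6.7
  (Mordell–Weil). [SilvermanAEC2009]
-/

noncomputable section

open scoped Classical

open WeierstrassCurve

namespace Literature.NumberTheory.EllipticCurves

/-! ## §1. The `p`-adic size of a rational number with `p` in the denominator -/

/-- **`p ∣ den(x) ⇒ ‖x‖_p > 1`** for `x ∈ ℚ` and a prime `p`: `max(1, ‖x‖_p) = p ^ ord_p(den x)`
(tree `WeierstrassCurve.max_one_norm_ratCast`, numerator and denominator being coprime) and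
`ord_p(den x) ≥ 1`. Private plumbing (an uncited elementary valuation fact). [folklore] -/
private theorem one_lt_padicNorm_ratCast_of_dvd_den (p : ℕ) [Fact p.Prime] {x : ℚ} (hx : p ∣ x.den) :
    1 < ‖(x : ℚ_[p])‖ := by
  have hp1 : (1 : ℝ) < p := by exact_mod_cast (Fact.out : p.Prime).one_lt
  have hv : 1 ≤ padicValNat p x.den := one_le_padicValNat_of_dvd x.den_nz hx
  have hlt : (1 : ℝ) < (p : ℝ) ^ (padicValNat p x.den : ℤ) :=
    one_lt_zpow₀ hp1 (by exact_mod_cast hv)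
  rw [← max_one_norm_ratCast p x, lt_max_iff] at hlt
  exact hlt.resolve_left (lt_irrefl _)

/-! ## §2. Kind `NL`: a denominator divisible by an odd prime -/

section Rat

variable (W : WeierstrassCurve ℚ) [W.IsElliptic] [W.IsGloballyMinimal] (p : ℕ) [Fact p.Prime]

/-- **Kind `NL` — a rational point whose `x`-coordinate has a denominator divisible by an odd prime
has infinite order** (Silverman AEC VII.3.4 with IV.6.1: on a `ℤ`-integral Weierstrass model a
torsion point `P` with `p ∣ den x(P)`, `p` odd, would be a torsion point of `E₁(ℚ_p)`, which has
none since `v(p) = 1 < p − 1`; tree `not_isOfFinAddOrder_of_one_lt_padicNorm_holds`, by division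
polynomials). For `W/ℚ` globally minimal (hence `ℤ`-integral), `p ≥ 3` ANY prime — no reduction
hypothesis at `p`. The hypothesis `p ∣ x.den` is decidable.
[cite: SilvermanAEC2009, VII.3.4] -/
theorem not_isOfFinAddOrder_of_dvd_den (hp : 3 ≤ p) {x y : ℚ} (h : W.toAffine.Nonsingular x y)
    (hx : p ∣ x.den) : ¬ IsOfFinAddOrder (.some x y h : W.toAffine.Point) :=
  not_isOfFinAddOrder_of_one_lt_padicNorm_holds W p hp h (one_lt_padicNorm_ratCast_of_dvd_den p hx)

/-- Kind `NL`, multiples form: `n • P ≠ O` for every `n > 0`. [cite: SilvermanAEC2009, VII.3.4] -/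
theorem nsmul_ne_zero_of_dvd_den (hp : 3 ≤ p) {x y : ℚ} (h : W.toAffine.Nonsingular x y)
    (hx : p ∣ x.den) {n : ℕ} (hn : 0 < n) : n • (.some x y h : W.toAffine.Point) ≠ 0 :=
  fun h0 ↦ not_isOfFinAddOrder_of_dvd_den W p hp h hx (isOfFinAddOrder_iff_nsmul_eq_zero.mpr ⟨n, hn, h0⟩)

/-! ## §3. Kind `NRED`: `#Ẽ(𝔽_p) • T ≠ O` at a good odd prime -/

/-- **Kind `NRED` — if `N_p • T ≠ O` for a good odd prime `p` (`p ∤ Δ_W`, `N_p = #Ẽ(𝔽_p)`), then the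
rational point `T` has infinite order**: the order of a rational torsion point divides `N_p`
(reduction `E(ℚ_p) → Ẽ(𝔽_p)` is a homomorphism with kernel `E₁(ℚ_p)`, AEC VII.2.1, and
`E₁(ℚ_p) ∩ E(ℚ)` is torsion-free for `p` odd, VII.3.1(b)/VII.3.4; tree
`reductionPointCount_nsmul_eq_zero_of_isOfFinAddOrder`). One prime suffices; a point passing the
two-prime test `RED2` (different reduction orders at two good odd primes) passes `NRED` at each of
them. [cite: SilvermanAEC2009, VII.3.1(b)] -/
theorem not_isOfFinAddOrder_of_reductionPointCount_nsmul_ne_zero (hp : 3 ≤ p)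
    (hΔ : ¬ (p : ℤ) ∣ minimalDiscriminantInt W) {T : W.toAffine.Point}
    (hT : W.reductionPointCount p • T ≠ 0) : ¬ IsOfFinAddOrder T :=
  fun hfin ↦ hT (reductionPointCount_nsmul_eq_zero_of_isOfFinAddOrder W p hp hΔ hfin)

/-! ## §4. `1 ≤ rank_ℤ E(ℚ)` from one certified point (the consumer input `hr₁`, `r₁ = 1`) -/

omit [W.IsGloballyMinimal] in
/-- **A rational point of infinite order gives `1 ≤ rank_ℤ E(ℚ)`** — the glue
`one_le_mordellWeilRank_of_not_isOfFinAddOrder` (`n ↦ n • P` injective `ℤ → E(ℚ)`) with the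
Mordell–Weil theorem `module_finite_point_holds` (AEC VIII.6.7) supplying finite generation.
[cite: SilvermanAEC2009, Thm. VIII.6.7] -/
theorem one_le_mordellWeilRank_of_not_isOfFinAddOrder_rat {P : W.toAffine.Point}
    (hP : ¬ IsOfFinAddOrder P) : 1 ≤ W.mordellWeilRank := by
  -- the group law on `E(ℚ)` is stated in the tree for the classical `DecidableEq ℚ` instance
  -- (`mordellWeilRank`, generic over the base field) and here for `instDecidableEqRat`; the two
  -- instances are equal (`Subsingleton`), so `convert` transports the hypothesis.
  refine one_le_mordellWeilRank_of_not_isOfFinAddOrder W W.module_finite_point_holds (P := P) ?_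
  convert hP

/-- **`1 ≤ rank_ℤ E(ℚ)` from a kind-`NL` certificate**: a rational point `(x, y)` on the globally
minimal model with `p ∣ den(x)` for an odd prime `p`. One theorem call per row; hypotheses
`Nonsingular x y` and `p ∣ x.den` are decidable. [cite: SilvermanAEC2009, VII.3.4 and Thm. VIII.6.7] -/
theorem one_le_mordellWeilRank_of_dvd_den (hp : 3 ≤ p) {x y : ℚ} (h : W.toAffine.Nonsingular x y)
    (hx : p ∣ x.den) : 1 ≤ W.mordellWeilRank :=
  one_le_mordellWeilRank_of_not_isOfFinAddOrder_rat W (not_isOfFinAddOrder_of_dvd_den W p hp h hx)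

/-- **`1 ≤ rank_ℤ E(ℚ)` from a kind-`NRED` certificate**: a rational point `T` and a good odd prime
`p` with `#Ẽ(𝔽_p) • T ≠ O`. [cite: SilvermanAEC2009, VII.3.1(b) and Thm. VIII.6.7] -/
theorem one_le_mordellWeilRank_of_reductionPointCount_nsmul_ne_zero (hp : 3 ≤ p)
    (hΔ : ¬ (p : ℤ) ∣ minimalDiscriminantInt W) {T : W.toAffine.Point}
    (hT : W.reductionPointCount p • T ≠ 0) : 1 ≤ W.mordellWeilRank :=
  one_le_mordellWeilRank_of_not_isOfFinAddOrder_rat W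
    (not_isOfFinAddOrder_of_reductionPointCount_nsmul_ne_zero W p hp hΔ hT)

end Rat

end Literature.NumberTheory.EllipticCurves

end
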